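import Literature.Computability.Complexity.NEXPCertificates
import Literature.Computability.Complexity.TimeHierarchyAE
import Literature.Computability.MetaComplexity.AvgCaseNE
import HarnessLib

/-!
# `NE ⊆ NEXP` in the tree's one-constant verifier form of `NTIME`

Literature / complexity toolkit. The tree's nondeterministic time classes (`Nondeterministic.lean`)
are `NTIME t` in the ONE-CONSTANT verifier form (time AND admissible witness length `c · t n + c`
for a single `c`), `NE = ⋃_c NTIME(2^{cn})` and `NEXP = ⋃_k NTIME(2^{nᵏ})`. The textbook inclusion
`NE ⊆ NEXP` (Papadimitriou 1994, §20.1; Arora–Barak 2009, §2.6.2) is NOT a reindexing of the unions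
in this presentation: `2^{cn} ≤ 2^{n^k}` fails at `n = 1 < c` for every `k`, and monotonicity of
`NTIME` in the bound (`NTIME_mono_holds`) needs a pointwise inequality because the admissible
witness range grows with the bound. This file supplies the inclusion through the certificate
presentation of `NEXP` (`NEXPCertificates.lean`):

* `exists_certificates_of_mem_NTIME_two_pow_mul` — for `L ∈ NTIME(2^{an})`, `1 ≤ a`, there are
  `R ∈ P` and `c` with: every `x ∈ L` has a witness `y`, `|y| ≤ c·2^{a|x|} + c`, `⟨x, y⟩ ∈ R`, and
  `⟨x, y⟩ ∈ R` forces `x ∈ L` (the proof of `exists_certificates_of_mem_NTIME_two_pow` with the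
  time-constructible bound `2^{an}`, `isTimeConstructible_two_pow_mul`: normalise the verifier,
  pad honest witnesses by `1^{2^{an}}`, read acceptance off the clocked universal machine);
* `NTIME_two_pow_mul_subset_NEXP` — `NTIME(2^{an}) ⊆ NEXP` for every `a` (`a = 0` through
  `NTIME_one_subset_NTIME_two_pow`; `a ≥ 1` by `mem_NEXP_of_certificates` with `k = 2`, using
  `2^{an} ≤ 2^{a²} · 2^{n²}`);
* `NE_subset_NEXP`.

All proved; no named fact, no definition.

## References

* S. Arora, B. Barak, *Computational Complexity: A Modern Approach*, CUP 2009, §2.6.2 (`NEXP`,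
  exponential-certificate definition), Def. 2.1 / §2.1.2 [AroraBarak2009].
* C. H. Papadimitriou, *Computational Complexity*, Addison-Wesley 1994, §20.1 (`NE`, `NEXP`)
  [Papadimitriou1994].
-/

namespace Literature.Computability.Complexity

open _root_.Computability Turing Polynomial Brick Plumb NEXPCert
open scoped Notation

/-- `an ≤ a² + n²`, hence `2^{an} ≤ 2^{a²} · 2^{n²}`. [folklore] -/
theorem two_pow_mul_le_two_pow_sq_mul (a n : ℕ) : 2 ^ (a * n) ≤ 2 ^ (a ^ 2) * 2 ^ (n ^ 2) := by
  rw [← pow_add]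
  apply Nat.pow_le_pow_right Nat.two_pos
  nlinarith [sq_nonneg (a - n : ℤ), sq_abs (a - n : ℤ)]

/-- **Certificates for `NTIME(2^{an})`, `1 ≤ a`**: for `L ∈ NTIME(2^{an})` there are `R ∈ P`
and `c` such that every `x ∈ L` has a witness of length `≤ c·2^{a|x|} + c` in `R`, and
`⟨x, y⟩ ∈ R` forces `x ∈ L` for every `y`. The matrix `R` reads acceptance of the total
(normal-form, `exists_normalVerifier` for the time-constructible bound `2^{an}`) verifier of `L`,
applied to `⟨x, first component of y⟩`, off the clocked universal machine of
`clockedUniversalAcceptance_holds`, with budget polynomial in the length of the pair; honest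
witnesses carry a pad `1^{2^{an}}` that makes the verifier's time `a'(2^{an} + |y|) + a'`
polynomial in that length. (Verbatim the argument of `exists_certificates_of_mem_NTIME_two_pow`.)
[cite: AroraBarak2009, §2.6.2] -/
theorem exists_certificates_of_mem_NTIME_two_pow_mul {L : Language Bool} {a : ℕ} (ha : 1 ≤ a)
    (hL : L ∈ NTIME (fun n => 2 ^ (a * n))) :
    ∃ R ∈ Classes.P, ∃ c : ℕ,
      (∀ x ∈ L, ∃ y : List Bool, y.length ≤ c * 2 ^ (a * x.length) + c ∧ boolPair x y ∈ R) ∧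
      (∀ x y : List Bool, boolPair x y ∈ R → x ∈ L) := by
  obtain ⟨c, R₀, M, hM, hLR⟩ := hL
  obtain ⟨R', M', a', hM', hL', hshort⟩ :=
    exists_normalVerifier (isTimeConstructible_two_pow_mul ha) hM hLR
  -- the projection `⟨x, ⟨y, pad⟩⟩ ↦ ⟨x, y⟩` followed by the total verifier
  have hproj : fanoutFn fstF (fstF ∘ sndF) ∈ FP :=
    fanoutFn_mem_FP fstF_mem_FP (comp_mem_FP fstF_mem_FP sndF_mem_FP)
  obtain ⟨ph, H, hH⟩ := hproj
  let V₂ : TM2ComputableAux Bool Bool := H.comp M'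
  have hV₂ : ∀ z : List Bool, V₂.OutputsWithin z (encodeBool (R' (fstF z) (fstF (sndF z))))
      (a' * (2 ^ (a * (fstF z).length) + (fstF (sndF z)).length) + a' + ph.eval z.length) :=
    fun z => by
    have h1 : H.OutputsWithin z (boolPair (fstF z) (fstF (sndF z))) (ph.eval z.length) := by
      have := hH z
      simpa [fanoutFn_apply] using this
    exact Turing.TM2ComputableAux.comp_outputsWithin _ _ h1 (hM' _ _)
  obtain ⟨U, hU, hUniv⟩ := clockedUniversalAcceptance_holds
  obtain ⟨e, p, hcomplete, hsnd⟩ := hUniv V₂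
  let T : Polynomial ℕ := Polynomial.C a' * (X + X) + Polynomial.C a' + ph
  let q : Polynomial ℕ := p.comp T
  let g : List Bool → List Bool := fanoutFn (fun _ => e) (fanoutFn id (polyFn q))
  have hg_apply : ∀ z, g z = boolPair e (boolPair z (ones (q.eval z.length))) := fun z => by
    simp only [g]
    rw [fanoutFn_apply, fanoutFn_apply, polyFn_apply]
    rfl
  refine ⟨(g ⁻¹' U : Language Bool), ?_, 2 * c + 2, ?_, ?_⟩
  · -- the matrix is in `P`
    exact preimage_mem_P hU
      (fanoutFn_mem_FP (const_mem_FP e) (fanoutFn_mem_FP OracleCompose.id_mem_FP (polyFn_mem_FP q)))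
  · -- completeness: pad the shortened witness
    intro x hx
    obtain ⟨y₀, hy₀⟩ := (hL' x).1 hx
    obtain ⟨hlen, hy₁⟩ := hshort x y₀ hy₀
    set y₁ := y₀.take (c * 2 ^ (a * x.length) + c) with hy₁def
    refine ⟨boolPair y₁ (ones (2 ^ (a * x.length))), ?_, ?_⟩
    · simp only [length_boolPair, List.length_replicate]
      have : y₁.length ≤ c * 2 ^ (a * x.length) + c := hlen
      nlinarith [Nat.one_le_two_pow (n := a * x.length)]
    · set z := boolPair x (boolPair y₁ (ones (2 ^ (a * x.length)))) with hz
      show g z ∈ U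
      rw [hg_apply]
      have hrun := hV₂ z
      have e1 : fstF z = x := by simp [hz]
      have e2 : fstF (sndF z) = y₁ := by simp [hz]
      rw [e1, e2, hy₁, show encodeBool true = [true] from rfl] at hrun
      refine hcomplete z _ _ hrun ?_
      show p.eval _ ≤ (p.comp T).eval z.length
      rw [eval_comp]
      apply TM2Iter.eval_mono
      have hzlen : z.length = 2 * x.length + 2 + (2 * y₁.length + 2 + 2 ^ (a * x.length)) := by
        simp [hz, length_boolPair]
      simp only [T, eval_add, eval_mul, eval_C, eval_X]
      nlinarith
  · -- soundness: the universal machine only accepts what `V₂` accepts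
    intro x y hxy
    have hxy' : g (boolPair x y) ∈ U := hxy
    rw [hg_apply] at hxy'
    obtain ⟨t, ht⟩ := hsnd _ _ hxy'
    have h2 := hV₂ (boolPair x y)
    simp only [fstF_boolPair, sndF_boolPair] at h2
    have huniq : [true] = encodeBool (R' x (fstF y)) :=
      List.map_injective_iff.2 V₂.outputAlphabet.symm.injective (TM2Std.outputs_unique V₂.tm ht h2)
    have hR' : R' x (fstF y) = true := by
      cases h : R' x (fstF y)
      · rw [h] at huniq
        exact absurd huniq (by decide)
      · rfl
    exact (hL' x).2 ⟨_, hR'⟩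

/-- **`NTIME(2^{an}) ⊆ NEXP`** for every `a`, in the tree's one-constant verifier form: for
`a = 0` the class is `NTIME(1) ⊆ NTIME(2ⁿ) = NTIME(2^{n¹}) ⊆ NEXP`
(`NTIME_one_subset_NTIME_two_pow`); for `a ≥ 1` take the certificates of
`exists_certificates_of_mem_NTIME_two_pow_mul` and weaken the witness bound along
`2^{an} ≤ 2^{a²} · 2^{n²}` before re-entering `NEXP` by `mem_NEXP_of_certificates` (`k = 2`).
[cite: AroraBarak2009, §2.6.2] [cite: Papadimitriou1994, §20.1] -/
theorem NTIME_two_pow_mul_subset_NEXP (a : ℕ) : NTIME (fun n => 2 ^ (a * n)) ⊆ NEXP := by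
  intro L hL
  rcases Nat.eq_zero_or_pos a with rfl | ha
  · have h1 : L ∈ NTIME (fun n => 2 ^ (1 * n)) :=
      Literature.Computability.MetaComplexity.NTIME_one_subset_NTIME_two_pow hL
    simp only [NEXP, Set.mem_iUnion]
    exact ⟨1, by simpa only [one_mul, pow_one] using h1⟩
  · obtain ⟨R, hR, c, hcomp, hsound⟩ := exists_certificates_of_mem_NTIME_two_pow_mul ha hL
    refine mem_NEXP_of_certificates hR 2 (c * 2 ^ (a ^ 2)) (fun x hx => ?_) hsound
    obtain ⟨y, hy, hyR⟩ := hcomp x hx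
    refine ⟨y, hy.trans ?_, hyR⟩
    have h1 : c * 2 ^ (a * x.length) ≤ c * 2 ^ (a ^ 2) * 2 ^ (x.length ^ 2) := by
      rw [mul_assoc]
      exact Nat.mul_le_mul_left c (two_pow_mul_le_two_pow_sq_mul a x.length)
    have h2 : c ≤ c * 2 ^ (a ^ 2) := Nat.le_mul_of_pos_right c Nat.one_le_two_pow
    exact Nat.add_le_add h1 h2

/-- **`NE ⊆ NEXP`** (`NE = ⋃_c NTIME(2^{cn})`, `NEXP = ⋃_k NTIME(2^{nᵏ})`; Papadimitriou 1994,
§20.1: "`NE ⊆ NEXP`"). [cite: Papadimitriou1994, §20.1] [cite: AroraBarak2009, §2.6.2] -/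
theorem NE_subset_NEXP : NE ⊆ NEXP := by
  intro L hL
  simp only [NE, Set.mem_iUnion] at hL
  obtain ⟨a, ha⟩ := hL
  exact NTIME_two_pow_mul_subset_NEXP a ha

end Literature.Computability.Complexity
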